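import Summits.Ventures.CertifiedManyBodySolver.Observables.SourcedGibbsTrialCapKSpaceRiemannDensity
import Literature.LinearAlgebra.Matrix.HermitianMatrixFunctionLipschitz
import HarnessLib

/-!
# The AF–BCS sourced cap in momentum space (XV-a): scalar Lipschitz constants of the Fermi integrands and the
# entrywise Lipschitz bound for Fermi matrices of Hermitian Bloch blocks

Cell hubbard-obs (row «pinning-field response menu nodes — Hellmann–Feynman brackets», seat hubbard-obs-pin-2).
HONEST FRAMING: zero compute; proved real-analysis / matrix-analysis lemmas towards the uniform-in-`L` (thermodynamic
limit) packaging of the certified AF–BCS cap `groundEnergy_dWaveSourceTorus_le_AFBCS_kSpace` (the plan is the deposit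
note `AF-TL-PACKAGING.md` of the cell): the one-body densities of the trial state are entries of `f_β(H(k))` for the
`4 × 4` antiferromagnetic Nambu block `H(k)`, and `f_β(H(k))` is Lipschitz in `k` with constant `Lip(f_β)·Lip_HS(H)` by
the Hilbert–Schmidt Lipschitz bound of `Literature/LinearAlgebra/Matrix/HermitianMatrixFunctionLipschitz`. No number is
claimed; not a statement about order; not a superconductivity verdict.

* `abs_fermi_sub_fermi_le` — the Fermi function `f_β(x) = (1 − tanh(βx/2))/2` is `β/4`-Lipschitz (`β ≥ 0`);
* `abs_mul_fermi_sub_mul_fermi_le` — the energy integrand `x·f_β(x)` is `5/4`-Lipschitz, uniformly in `β`;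
* `lipschitzWith_fermi`, `lipschitzWith_mul_fermi` — the same in `LipschitzWith` form;
* `norm_fermi_cfc_sub_apply_le`, `norm_mul_fermi_cfc_sub_apply_le` — for Hermitian `X, Y`: every entry of
  `f_β(X) − f_β(Y)` is at most `(β/4)·‖X − Y‖_HS`, and of `Xf_β(X) − Yf_β(Y)` at most `(5/4)·‖X − Y‖_HS`.

References: Davis–Rabinowitz (1984) §2.1 [DavisRabinowitz1984]; Bach–Lieb–Solovej (1994) §2 (quasi-free states and
their one-body densities) [BachLiebSolovej1994]; Rosenblum–Rovnyak (1985) Ch. 2 Addenda no. 3 Lemma A [RosenblumRovnyak1985].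
-/

noncomputable section

open Real Finset Matrix

namespace Summit.Ventures.CertifiedManyBodySolver.Observables

/-! ### §1 Scalar Lipschitz constants -/

/-- The Fermi function `x ↦ (1 − tanh(βx/2))/2` is `β/4`-Lipschitz for `β ≥ 0`. [folklore] -/
theorem abs_fermi_sub_fermi_le {β : ℝ} (hβ : 0 ≤ β) (x y : ℝ) :
    |(1 - Real.tanh (β * x / 2)) / 2 - (1 - Real.tanh (β * y / 2)) / 2| ≤ β / 4 * |x - y| := by
  have h := abs_tanh_sub_tanh_le (β * x / 2) (β * y / 2)
  rw [show β * x / 2 - β * y / 2 = β / 2 * (x - y) by ring, abs_mul, abs_of_nonneg (by positivity : 0 ≤ β / 2)] at h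
  rw [show (1 - Real.tanh (β * x / 2)) / 2 - (1 - Real.tanh (β * y / 2)) / 2 =
      -(1 / 2) * (Real.tanh (β * x / 2) - Real.tanh (β * y / 2)) by ring, abs_mul, abs_neg,
    abs_of_nonneg (by norm_num : (0 : ℝ) ≤ 1 / 2)]
  nlinarith [abs_nonneg (x - y)]

/-- The energy integrand `x ↦ x(1 − tanh(βx/2))/2 = x·f_β(x)` is `5/4`-Lipschitz, uniformly in `β`
(`x/2` is `1/2`-Lipschitz and `x tanh(βx/2)/2` is `3/4`-Lipschitz by `abs_mul_tanh_sub_mul_tanh_le`). [folklore] -/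
theorem abs_mul_fermi_sub_mul_fermi_le (β x y : ℝ) :
    |x * ((1 - Real.tanh (β * x / 2)) / 2) - y * ((1 - Real.tanh (β * y / 2)) / 2)| ≤ 5 / 4 * |x - y| := by
  have h := abs_mul_tanh_sub_mul_tanh_le β x y
  rw [show x * ((1 - Real.tanh (β * x / 2)) / 2) - y * ((1 - Real.tanh (β * y / 2)) / 2) =
      (1 / 2) * (x - y) + (-(1 / 2)) * (x * Real.tanh (β * x / 2) - y * Real.tanh (β * y / 2)) by ring]
  refine (abs_add_le _ _).trans ?_
  rw [abs_mul, abs_mul, abs_neg, abs_of_nonneg (by norm_num : (0 : ℝ) ≤ 1 / 2)]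
  linarith

/-- `LipschitzWith` form of `abs_fermi_sub_fermi_le` (constant `(β/4).toNNReal`). [folklore] -/
theorem lipschitzWith_fermi {β : ℝ} (hβ : 0 ≤ β) :
    LipschitzWith (β / 4).toNNReal (fun x : ℝ => (1 - Real.tanh (β * x / 2)) / 2) := by
  refine LipschitzWith.of_dist_le_mul fun x y => ?_
  rw [Real.dist_eq, Real.dist_eq, Real.coe_toNNReal _ (by positivity)]
  exact abs_fermi_sub_fermi_le hβ x y

/-- `LipschitzWith` form of `abs_mul_fermi_sub_mul_fermi_le` (constant `(5/4).toNNReal`). [folklore] -/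
theorem lipschitzWith_mul_fermi (β : ℝ) :
    LipschitzWith (5 / 4 : ℝ).toNNReal (fun x : ℝ => x * ((1 - Real.tanh (β * x / 2)) / 2)) := by
  refine LipschitzWith.of_dist_le_mul fun x y => ?_
  rw [Real.dist_eq, Real.dist_eq, Real.coe_toNNReal _ (by norm_num)]
  exact abs_mul_fermi_sub_mul_fermi_le β x y

/-! ### §2 Entrywise Lipschitz bounds for Fermi matrices of Hermitian blocks -/

section Blocks

variable {ι : Type*} [Fintype ι] [DecidableEq ι]

/-- **Entries of Fermi matrices are `β/4`-Lipschitz in the Hilbert–Schmidt distance of the Hamiltonian**: for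
Hermitian `X, Y` and `β ≥ 0`, every entry of `f_β(X) − f_β(Y)` (`f_β(x) = (1 − tanh(βx/2))/2`, functional calculus)
has norm at most `(β/4)·√(Σ‖(X − Y)_{ij}‖²)`. [cite: RosenblumRovnyak1985, Ch. 2 Examples and Addenda no. 3 Lemma A] -/
theorem norm_fermi_cfc_sub_apply_le {β : ℝ} (hβ : 0 ≤ β) {X Y : Matrix ι ι ℂ} (hX : X.IsHermitian)
    (hY : Y.IsHermitian) (a b : ι) :
    ‖(cfc (fun x : ℝ => (1 - Real.tanh (β * x / 2)) / 2) X - cfc (fun x : ℝ => (1 - Real.tanh (β * x / 2)) / 2) Y) a b‖ ≤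
      β / 4 * Real.sqrt (∑ i, ∑ j, ‖(X - Y) i j‖ ^ 2) := by
  have h := Literature.LinearAlgebra.Matrix.norm_cfc_sub_cfc_apply_le_of_lipschitz hX hY (lipschitzWith_fermi hβ) a b
  rwa [Real.coe_toNNReal _ (by positivity)] at h

/-- **Entries of `H f_β(H)` are `5/4`-Lipschitz in the Hilbert–Schmidt distance**, uniformly in `β`: for Hermitian
`X, Y`, every entry of `g(X) − g(Y)`, `g(x) = x(1 − tanh(βx/2))/2`, has norm at most `(5/4)·√(Σ‖(X − Y)_{ij}‖²)`.
[cite: RosenblumRovnyak1985, Ch. 2 Examples and Addenda no. 3 Lemma A] -/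
theorem norm_mul_fermi_cfc_sub_apply_le (β : ℝ) {X Y : Matrix ι ι ℂ} (hX : X.IsHermitian) (hY : Y.IsHermitian)
    (a b : ι) :
    ‖(cfc (fun x : ℝ => x * ((1 - Real.tanh (β * x / 2)) / 2)) X -
        cfc (fun x : ℝ => x * ((1 - Real.tanh (β * x / 2)) / 2)) Y) a b‖ ≤
      5 / 4 * Real.sqrt (∑ i, ∑ j, ‖(X - Y) i j‖ ^ 2) := by
  have h := Literature.LinearAlgebra.Matrix.norm_cfc_sub_cfc_apply_le_of_lipschitz hX hY (lipschitzWith_mul_fermi β) a b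
  rwa [Real.coe_toNNReal _ (by norm_num)] at h

end Blocks

end Summit.Ventures.CertifiedManyBodySolver.Observables
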